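import Summits.ValiantsHypothesis.ValiantsHypothesis.Theorems.UniqStep.Negative.GaugeInvariants
import Literature.Computability.AlgebraicComplexity.LRPencilOfMatrix
import Mathlib.LinearAlgebra.Matrix.Rank
import Mathlib.Data.Matrix.Basis

/-! # Crux `UniqStep` (stmt-ValiantsHypothesis-17834), line `Sketch` (phase 2: the purified source twist) — stub `stub_rankToolkit`:
# the coefficient-rank profile is a gauge invariant, `rank (E_{ac} + E_{bc} + E_{ad}) = 2`, and row
# permutations preserve coefficient ranks

WHAT. Three general facts of linear algebra, for matrices of polynomials
`A, B : Matrix (Fin m) (Fin m) (MvPolynomial (Fin n × Fin n) ℂ)` and their coefficient matrices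
`coeffMat A v` (the matrix of coefficients of the variable `X v`, `LRPencilOfMatrix.lean`):
(a) if `A` is honest (every cell `X v` or `C c`) and `B = P · A(γx) · Q` or `B = P · A(γx)ᵀ · Q` with
constant `P, Q ∈ GL_m(ℂ)` and `γ ∈ permSymmetrySubst ℂ n`, then there is an injective relabelling `w`
of the variables with `rank (coeffMat B v) = rank (coeffMat A (w v))` for every `v` — because every
realised symmetry of `per_n` acts MONOMIALLY on the `n²` variables, so `coeffMat (A(γx)) v` is a
non-zero scalar multiple of one `coeffMat A (w v)`; this is exactly the tree's
`UniqStep.Negative.GaugeInvariants.exists_injective_rank_coeffMat_eq` (refuter seat, every `(n, m)`),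
which we re-export in the registered shape;
(b) for `a ≠ b`, `c ≠ d` in `Fin m` the matrix `E_{ac} + E_{bc} + E_{ad}` has rank `2`: it is the sum
of the two rank-`≤ 1` matrices `(e_a + e_b) ⊗ e_c` and `e_a ⊗ e_d`, and its `2 × 2` submatrix on the
rows `a, b` and the columns `c, d` is the invertible `!![1, 1; 1, 0]`;
(c) `coeffMat` is an entrywise map, so `coeffMat (B.submatrix σ id) v = (coeffMat B v).submatrix σ id`,
whose rank is that of `coeffMat B v` for a permutation `σ` of the rows.

WHY. Stub V6 of the line: in the composition `UniqStep_of`, (a) says the multiset of coefficient ranks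
is an invariant of the crux's gauge relation; the purified source twist `K_n` has an
`X(0,0)`-coefficient matrix of the shape in (b) (stub V5), hence of rank `2`, also after the row swap
that fixes the sign of its determinant for odd `k` (c); no coefficient matrix of Grenet's matrix has
rank `2` (stub V7), so the two optimal honest projections of `per_n` are inequivalent, `Uniq n` fails
and `UniqStep` holds vacuously.

SOURCE. This session's construction (computations `compute/purify_*.py`); Grenet's matrix is from
B. Grenet, *An upper bound for the permanent versus determinant problem* (2011); the `(3, 7)` twist is
from J. Hüttenhain, C. Ikenmeyer, *Binary determinantal complexity*, Linear Algebra Appl. 504 (2016);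
the monomiality of the realised symmetry group is Landsberg–Ressayre 2017, §2.1.  The lemmas here are
elementary linear algebra over `ℂ`.
-/

-- D-0017 layout: Sub = Summit for this single-conjunct summit, so the namespace repeats a component.
set_option linter.dupNamespace false

namespace Summit.ValiantsHypothesis.ValiantsHypothesis.Theorems.ProjectionStabilityUniqStep

open MvPolynomial
open scoped BigOperators Matrix
open Literature.Computability.AlgebraicComplexity
open Literature.Computability.AlgebraicComplexity.LRPencil

noncomputable section

/-! ### Helpers -/

/-- `rank (E_{ac} + E_{bc} + E_{ad}) = 2` for `a ≠ b`, `c ≠ d`: at most `2` as a sum of the two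
rank-`≤ 1` matrices `(e_a + e_b) ⊗ e_c` and `e_a ⊗ e_d`, at least `2` because the submatrix on the rows
`a, b` and the columns `c, d` is the invertible `!![1, 1; 1, 0]`. [folklore] -/
theorem rank_single_add_single_add_single {m : ℕ} {a b c d : Fin m} (hab : a ≠ b) (hcd : c ≠ d) :
    (Matrix.single a c (1 : ℂ) + Matrix.single b c 1 + Matrix.single a d 1).rank = 2 := by
  apply le_antisymm
  · -- upper bound: sub-additivity of the rank and two rank-`≤ 1` summands
    have hsub : ∀ M N : Matrix (Fin m) (Fin m) ℂ, (M + N).rank ≤ M.rank + N.rank := fun M N => by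
      unfold Matrix.rank
      rw [Matrix.mulVecLin_add]
      exact (Submodule.finrank_mono (LinearMap.range_add_le _ _)).trans
        (Submodule.finrank_add_le_finrank_add_finrank _ _)
    have h1 : (Matrix.single a c (1 : ℂ) + Matrix.single b c 1).rank ≤ 1 := by
      rw [Matrix.single_eq_single_vecMulVec_single, Matrix.single_eq_single_vecMulVec_single,
        ← Matrix.add_vecMulVec]
      exact Matrix.rank_vecMulVec_le _ _
    have h2 : (Matrix.single a d (1 : ℂ)).rank ≤ 1 := by
      rw [Matrix.single_eq_single_vecMulVec_single]
      exact Matrix.rank_vecMulVec_le _ _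
    exact (hsub _ _).trans (add_le_add h1 h2)
  · -- lower bound: an invertible `2 × 2` submatrix
    have hS : (Matrix.single a c (1 : ℂ) + Matrix.single b c 1 + Matrix.single a d 1).submatrix
        ![a, b] ![c, d] = !![1, 1; 1, 0] := by
      ext i j
      fin_cases i <;> fin_cases j <;>
        simp [hab, hcd, hab.symm, hcd.symm]
    have hU : IsUnit (!![1, 1; 1, 0] : Matrix (Fin 2) (Fin 2) ℂ) := by
      rw [Matrix.isUnit_iff_isUnit_det, Matrix.det_fin_two_of]
      norm_num
    calc 2 = ((Matrix.single a c (1 : ℂ) + Matrix.single b c 1 + Matrix.single a d 1).submatrix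
          ![a, b] ![c, d]).rank := by
          rw [hS, Matrix.rank_of_isUnit _ hU, Fintype.card_fin]
      _ ≤ _ := Matrix.rank_submatrix_le _ _ _

/-- `coeffMat` commutes with reindexing the rows: `coeffMat (B.submatrix σ id) v = (coeffMat B v).submatrix σ id`
(it is an entrywise map). [folklore] -/
theorem coeffMat_submatrix {n m : ℕ} (B : Matrix (Fin m) (Fin m) (MvPolynomial (Fin n × Fin n) ℂ))
    (σ : Fin m → Fin m) (v : Fin n × Fin n) :
    coeffMat (B.submatrix σ id) v = (coeffMat B v).submatrix σ id := rfl

/-- Row permutations do not change coefficient ranks. [folklore] -/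
theorem rank_coeffMat_submatrix_perm {n m : ℕ} (B : Matrix (Fin m) (Fin m) (MvPolynomial (Fin n × Fin n) ℂ))
    (σ : Equiv.Perm (Fin m)) (v : Fin n × Fin n) :
    (coeffMat (B.submatrix σ id) v).rank = (coeffMat B v).rank := by
  rw [coeffMat_submatrix]
  exact Matrix.rank_submatrix (coeffMat B v) σ (Equiv.refl (Fin m))

/-! ### The registered stub -/

/-- **STUB V6** of line `Sketch` (phase 2) of crux `UniqStep` — rank toolkit. (a) The coefficient-rank
profile is an invariant of the crux's gauge relation (`γ ∈ permSymmetrySubst` is a monomial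
substitution; the tree's `UniqStep.Negative.GaugeInvariants.exists_injective_rank_coeffMat_eq`, any
`(n, m)`); (b) `rank (E_{ac} + E_{bc} + E_{ad}) = 2` for `a ≠ b`, `c ≠ d`; (c) row permutations do not
change coefficient ranks. [folklore] -/
theorem stub_rankToolkit :
    (∀ (n m : ℕ) (A B : Matrix (Fin m) (Fin m) (MvPolynomial (Fin n × Fin n) ℂ))
        (P Q : GL (Fin m) ℂ) (γ : GL (Fin n × Fin n) ℂ), γ ∈ permSymmetrySubst ℂ n →
      (∀ i j, (∃ v, A i j = X v) ∨ ∃ c, A i j = C c) →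
      (B = (P : Matrix _ _ ℂ).map C * Matrix.linSubstEntries γ A * (Q : Matrix _ _ ℂ).map C ∨
        B = (P : Matrix _ _ ℂ).map C * (Matrix.linSubstEntries γ A)ᵀ * (Q : Matrix _ _ ℂ).map C) →
      ∃ w : Fin n × Fin n → Fin n × Fin n, Function.Injective w ∧
        ∀ v, (coeffMat B v).rank = (coeffMat A (w v)).rank) ∧
    (∀ (m : ℕ) (a b c d : Fin m), a ≠ b → c ≠ d →
      (Matrix.single a c (1 : ℂ) + Matrix.single b c 1 + Matrix.single a d 1).rank = 2) ∧
    (∀ (n m : ℕ) (B : Matrix (Fin m) (Fin m) (MvPolynomial (Fin n × Fin n) ℂ)) (σ : Equiv.Perm (Fin m)) (v : Fin n × Fin n),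
      (coeffMat (B.submatrix σ id) v).rank = (coeffMat B v).rank) :=
  ⟨fun _ _ _ _ _ _ _ hγ hA h =>
      Summit.ValiantsHypothesis.ValiantsHypothesis.Theorems.UniqStep.Negative.GaugeInvariants.exists_injective_rank_coeffMat_eq
        hγ hA h,
    fun _ _ _ _ _ hab hcd => rank_single_add_single_add_single hab hcd,
    fun _ _ B σ v => rank_coeffMat_submatrix_perm B σ v⟩

end

end Summit.ValiantsHypothesis.ValiantsHypothesis.Theorems.ProjectionStabilityUniqStep
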